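import Mathlib
import Literature.Analysis.FluidPDE.LocalBiotSavartHelmholtz
import HarnessLib

/-!
# Line `vortical_centre` (Sb): the divergence-free hypothesis of H2♭ `ShellKernelBound` is load-bearing — refuter lane ns-afl-r1

Supports crux stmt-NavierStokesRegularity-24077 (`QuarterLogPincer.TypeIQuantSubcubicExp`) via ns-idea-7's line
`Cruxes/TypeIQuantSubcubicExp/Lines/vortical_centre.lean` (v1.2, sha16 c2440fd4cdc9a802), whose single open stub is
H2♭ `HelmholtzCentre.ShellKernelBound`: for `v ∈ C²(ℝ³;ℝ³)` DIVERGENCE FREE and `R > 0`,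
`‖v(y) − K∗(χ_{y,R} curl v)(y)‖ ≤ C(R⁻³∫_{B(y,R)}‖v‖ + R⁻²∫_{B(y,R)}‖curl v‖)` (`χ_{y,R} = ballCutoff y (R/3)`).

* `shellKernelBound_false_without_divFree` — the NEGATION of H2♭-without-`IsDivFree`, the statement written out
  VERBATIM (the line's `cutVorticity v y R x = ballCutoff y (R/3) x • curl v x` inlined; the line file is a Cruxes
  workfile and cannot be imported here; theorem-only file, no definitions).  WITNESS: the compactly supported gradient
  field `v = ∇θ`, `θ(x) = ⟨e₀, x⟩·ballCutoff 0 1 (x)`: `curl v ≡ 0` (tree `curl_gradient_eq_zero_holds`), so the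
  Biot–Savart term and the enstrophy term vanish identically, `v(0) = e₀` has norm `1`, while
  `R⁻³∫_{B(0,R)}‖v‖ ≤ R⁻³‖v‖_{L¹} → 0` as `R → ∞`.  So any proof of H2♭ must use `div v = 0` — on paper it enters
  exactly once, in the cancellation `χΔv + χ curl curl v = 0` behind the tree's `laplacian_smul_add_curl_smul_curl_eq`.

HONEST FRAME: linear vector calculus about one hypothesis of one stub four levels below the crux; nothing here bears on
24077's truth, W7 or Navier–Stokes regularity (OPEN).  Refuter/instrument seat ns-afl-r1 g12, `--supports
stmt-NavierStokesRegularity-24077`, Negative lane (no Theses statement is asserted).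
-/

set_option linter.dupNamespace false

noncomputable section

open MeasureTheory Set Metric InnerProductSpace
open Literature.Analysis Literature.Analysis.FluidPDE

namespace Summit.NavierStokesRegularity.NavierStokesRegularity.Theorems.TypeIQuantSubcubicExp.Negative.HelmholtzCentre

/-! ### The witness: a compactly supported gradient field -/

/-- The potential `θ(x) = ⟨e₀, x⟩ · ballCutoff 0 1 (x)`. -/
theorem contDiff_potential {n : ℕ∞} :
    ContDiff ℝ n (fun x : EuclideanSpace ℝ (Fin 3) =>
      (innerSL ℝ (EuclideanSpace.single (0 : Fin 3) (1 : ℝ))) x * ballCutoff 0 1 x) :=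
  ((innerSL ℝ (EuclideanSpace.single (0 : Fin 3) (1 : ℝ))).contDiff.of_le le_top).mul
    (contDiff_ballCutoff 0 1)

/-- `θ` has compact support (inside `B̄(0,3)`). -/
theorem hasCompactSupport_potential :
    HasCompactSupport (fun x : EuclideanSpace ℝ (Fin 3) =>
      (innerSL ℝ (EuclideanSpace.single (0 : Fin 3) (1 : ℝ))) x * ballCutoff 0 1 x) :=
  (hasCompactSupport_ballCutoff (c := 0) one_pos).mul_left

/-- `Dθ(0) = ⟨e₀, ·⟩` (product rule: `θ = ℓ·χ` with `ℓ(0) = 0`, `χ(0) = 1`). -/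
theorem hasFDerivAt_potential_zero :
    HasFDerivAt (fun x : EuclideanSpace ℝ (Fin 3) =>
        (innerSL ℝ (EuclideanSpace.single (0 : Fin 3) (1 : ℝ))) x * ballCutoff 0 1 x)
      (innerSL ℝ (EuclideanSpace.single (0 : Fin 3) (1 : ℝ))) 0 := by
  set ℓ : EuclideanSpace ℝ (Fin 3) →L[ℝ] ℝ := innerSL ℝ (EuclideanSpace.single (0 : Fin 3) (1 : ℝ)) with hℓ
  have h1 : HasFDerivAt (fun x => ℓ x) ℓ 0 := ℓ.hasFDerivAt
  have hχd : DifferentiableAt ℝ (ballCutoff (0 : EuclideanSpace ℝ (Fin 3)) 1) 0 :=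
    ((contDiff_ballCutoff (0 : EuclideanSpace ℝ (Fin 3)) 1 (n := 1)).differentiable (by norm_num)) 0
  have h2 : HasFDerivAt (ballCutoff (0 : EuclideanSpace ℝ (Fin 3)) 1)
      (fderiv ℝ (ballCutoff (0 : EuclideanSpace ℝ (Fin 3)) 1) 0) 0 := hχd.hasFDerivAt
  have h := h1.mul h2
  have hχ0 : ballCutoff (0 : EuclideanSpace ℝ (Fin 3)) 1 0 = 1 :=
    ballCutoff_eq_one one_pos (by simp)
  have hℓ0 : ℓ 0 = 0 := map_zero ℓ
  rw [hℓ0, hχ0, zero_smul, zero_add, one_smul] at h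
  exact h

/-- The witness field `v = ∇θ` at the origin is `e₀`. -/
theorem gradient_potential_zero :
    gradient (fun x : EuclideanSpace ℝ (Fin 3) =>
        (innerSL ℝ (EuclideanSpace.single (0 : Fin 3) (1 : ℝ))) x * ballCutoff 0 1 x) 0 =
      EuclideanSpace.single (0 : Fin 3) (1 : ℝ) := by
  have h := hasFDerivAt_potential_zero.hasGradientAt
  -- `HasFDerivAt f ℓ x` gives `HasGradientAt f (toDual.symm ℓ) x`; identify `toDual.symm (innerSL e₀) = e₀`
  have he : (toDual ℝ (EuclideanSpace ℝ (Fin 3))).symm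
      (innerSL ℝ (EuclideanSpace.single (0 : Fin 3) (1 : ℝ))) = EuclideanSpace.single (0 : Fin 3) (1 : ℝ) := by
    apply (toDual ℝ (EuclideanSpace ℝ (Fin 3))).injective
    rw [LinearIsometryEquiv.apply_symm_apply]
    ext y
    simp [toDual_apply_apply]
  rw [he] at h
  exact h.gradient

/-- The witness field is `C^n` for every finite `n` (here we need `n = 2`). -/
theorem contDiff_gradient_potential :
    ContDiff ℝ 2 (gradient (fun x : EuclideanSpace ℝ (Fin 3) =>
        (innerSL ℝ (EuclideanSpace.single (0 : Fin 3) (1 : ℝ))) x * ballCutoff 0 1 x)) := by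
  have hθ := contDiff_potential (n := 3)
  have hD : ContDiff ℝ 2 (fderiv ℝ (fun x : EuclideanSpace ℝ (Fin 3) =>
      (innerSL ℝ (EuclideanSpace.single (0 : Fin 3) (1 : ℝ))) x * ballCutoff 0 1 x)) :=
    hθ.fderiv_right (by norm_cast)
  exact ((toDual ℝ (EuclideanSpace ℝ (Fin 3))).symm.toContinuousLinearEquiv.toContinuousLinearMap.contDiff).comp hD

/-- The witness field has compact support. -/
theorem hasCompactSupport_gradient_potential :
    HasCompactSupport (gradient (fun x : EuclideanSpace ℝ (Fin 3) =>
        (innerSL ℝ (EuclideanSpace.single (0 : Fin 3) (1 : ℝ))) x * ballCutoff 0 1 x)) := by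
  have h := (hasCompactSupport_potential.fderiv (𝕜 := ℝ)).comp_left
    (g := fun L : EuclideanSpace ℝ (Fin 3) →L[ℝ] ℝ => (toDual ℝ (EuclideanSpace ℝ (Fin 3))).symm L)
    (map_zero _)
  exact h

/-- The witness field is curl free (tree `curl_gradient_eq_zero_holds`). -/
theorem curl_gradient_potential (x : EuclideanSpace ℝ (Fin 3)) :
    curl (gradient (fun x : EuclideanSpace ℝ (Fin 3) =>
        (innerSL ℝ (EuclideanSpace.single (0 : Fin 3) (1 : ℝ))) x * ballCutoff 0 1 x)) x = 0 :=
  curl_gradient_eq_zero_holds _ (contDiff_potential (n := 2)) x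

/-! ### The load-bearing fact -/

/-- **`div v = 0` is load-bearing for H2♭ `ShellKernelBound`**: the same statement with the divergence-free hypothesis
dropped (written out verbatim, `cutVorticity` inlined) is FALSE — witnessed by the compactly supported gradient field
`∇(⟨e₀,x⟩·ballCutoff 0 1 x)` and the radius `R = C‖v‖_{L¹} + 1`. -/
theorem shellKernelBound_false_without_divFree :
    ¬ ∃ C : ℝ, 1 ≤ C ∧
      ∀ (v : (EuclideanSpace ℝ (Fin 3)) → (EuclideanSpace ℝ (Fin 3))), ContDiff ℝ 2 v →
        ∀ (y : EuclideanSpace ℝ (Fin 3)) (R : ℝ), 0 < R →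
          ‖v y - biotSavart (fun x => ballCutoff y (R / 3) x • curl v x) y‖ ≤
            C * ((R ^ 3)⁻¹ * (∫ x in ball y R, ‖v x‖) + (R ^ 2)⁻¹ * (∫ x in ball y R, ‖curl v x‖)) := by
  rintro ⟨C, hC, H⟩
  set v : EuclideanSpace ℝ (Fin 3) → EuclideanSpace ℝ (Fin 3) :=
    gradient (fun x : EuclideanSpace ℝ (Fin 3) =>
      (innerSL ℝ (EuclideanSpace.single (0 : Fin 3) (1 : ℝ))) x * ballCutoff 0 1 x) with hv
  have hv2 : ContDiff ℝ 2 v := contDiff_gradient_potential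
  have hcurl : ∀ x, curl v x = 0 := curl_gradient_potential
  have hv0 : ‖v 0‖ = 1 := by
    rw [hv, gradient_potential_zero]; simp
  -- integrability of `‖v‖`
  have hvi : Integrable (fun x => ‖v x‖) :=
    ((hv2.continuous).integrable_of_hasCompactSupport hasCompactSupport_gradient_potential).norm
  set I : ℝ := ∫ x, ‖v x‖ with hI
  have hI0 : 0 ≤ I := integral_nonneg fun _ => norm_nonneg _
  -- the radius
  set R : ℝ := C * I + 1 with hR
  have hC0 : 0 < C := by linarith
  have hR1 : 1 ≤ R := by rw [hR]; nlinarith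
  have hR0 : 0 < R := by linarith
  have key := H v hv2 0 R hR0
  -- the Biot–Savart and enstrophy terms vanish
  have hcut : (fun x => ballCutoff (0 : EuclideanSpace ℝ (Fin 3)) (R / 3) x • curl v x) = 0 := by
    funext x; simp [hcurl x]
  have hBS : biotSavart (fun x => ballCutoff (0 : EuclideanSpace ℝ (Fin 3)) (R / 3) x • curl v x) 0 = 0 := by
    rw [hcut, biotSavart_zero]; rfl
  have hens : (∫ x in ball (0 : EuclideanSpace ℝ (Fin 3)) R, ‖curl v x‖) = 0 := by
    simp [hcurl]
  rw [hBS, sub_zero, hv0, hens, mul_zero, add_zero] at key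
  -- the mass term is at most `I`
  set M : ℝ := ∫ x in ball (0 : EuclideanSpace ℝ (Fin 3)) R, ‖v x‖ with hM
  have hmass : M ≤ I :=
    setIntegral_le_integral hvi (Filter.Eventually.of_forall fun _ => norm_nonneg _)
  have hM0 : 0 ≤ M := setIntegral_nonneg measurableSet_ball fun _ _ => norm_nonneg _
  have hR2 : 1 ≤ R ^ 2 := by nlinarith
  have hR3 : R ≤ R ^ 3 := by nlinarith
  have hinv : (R ^ 3)⁻¹ ≤ R⁻¹ := inv_anti₀ hR0 hR3
  have h1 : C * ((R ^ 3)⁻¹ * M) ≤ C * (R⁻¹ * I) :=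
    mul_le_mul_of_nonneg_left (mul_le_mul hinv hmass hM0 (inv_nonneg.mpr hR0.le)) hC0.le
  have h2 : C * (R⁻¹ * I) < 1 := by
    rw [show C * (R⁻¹ * I) = C * I / R by ring, div_lt_one hR0, hR]
    linarith
  linarith

end Summit.NavierStokesRegularity.NavierStokesRegularity.Theorems.TypeIQuantSubcubicExp.Negative.HelmholtzCentre

end
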